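import Literature.Geometry.Lorentzian.SpacetimeReverse
import HarnessLib

/-!
# Pointed `Cᵏ_loc` convergence and time reversal

A `LocalSubconvergence` datum only sees the metrics, the comparison maps and ONE orientation
condition (`dφₙ` sends the orienting field of the limit to future-directed vectors). Reversing the
time orientation of all sources and of the limit simultaneously preserves the datum
(`LocalSubconvergence.reverse`); reversing only the sources is the same as reversing only the limit
(`LocalSubconvergence.ofReverseSources`, `LocalSubconvergence.toReverseSources`). Hence
`SubconvergesLocallyTo (fun n ↦ (𝓢ₙ n).reverse) pₙ 𝓣 q k ↔ SubconvergesLocallyTo 𝓢ₙ pₙ 𝓣.reverse q k`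
(`Spacetime.subconvergesLocallyTo_reverse_sources_iff`): the tool by which "unoriented"
compactness theorems are deduced from oriented ones (apply the oriented theorem to the reversed
sources along the subsequence where the charts are past-oriented).

## References
* B. O'Neill, *Semi-Riemannian geometry*, 1983, Ch. 5, p. 145 (time orientation and its reverse). [ONeill1983]
* P. Petersen, *Riemannian Geometry*, 2nd ed., 2006, Ch. 10 §3.2. [Petersen2006]
-/

noncomputable section

open Set Filter TopologicalSpace Function
open scoped Manifold ContDiff Topology

universe u v

namespace Literature.Geometry.Lorentzian

namespace Spacetime

namespace LocalSubconvergence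

variable {𝓢ₙ : ℕ → Spacetime.{u} 4} {pₙ : ∀ n, (𝓢ₙ n).carrier} {𝓣 : Spacetime.{v} 4}
  {q : 𝓣.carrier} {k : ℕ}

/-- **Reversing sources and limit together preserves a subconvergence datum.**
[cite: ONeill1983, Ch. 5, p. 145] -/
def reverse (D : LocalSubconvergence 𝓢ₙ pₙ 𝓣 q k) :
    LocalSubconvergence (fun n ↦ (𝓢ₙ n).reverse) pₙ 𝓣.reverse q k where
  sub := D.sub
  strictMono_sub := D.strictMono_sub
  U := D.U
  monotone_U := D.monotone_U
  mem_U := D.mem_U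
  iUnion_U := D.iUnion_U
  isCompact_closure_U := D.isCompact_closure_U
  embed := D.embed
  isLocalDiffeomorphOn_embed := D.isLocalDiffeomorphOn_embed
  injOn_embed := D.injOn_embed
  embed_basepoint := D.embed_basepoint
  isFutureDirected_mfderiv_embed n x hx := by
    have h := D.isFutureDirected_mfderiv_embed n x hx
    show (𝓢ₙ (D.sub n)).timeOrientation.reverse.IsFutureDirected
      (mfderiv (𝓡 4) (𝓡 4) (D.embed n) x (-(𝓣.timeOrientation.vectorField x)))
    have e := ContinuousLinearMap.map_neg (mfderiv (𝓡 4) (𝓡 4) (D.embed n) x)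
      (𝓣.timeOrientation.vectorField x)
    refine (Iff.of_eq (congrArg ((𝓢ₙ (D.sub n)).timeOrientation.reverse.IsFutureDirected) e)).2 ?_
    refine (TimeOrientation.isFutureDirected_reverse_iff _ _).2 ?_
    refine (TimeOrientation.isFutureDirected_neg_iff _ _).1 ?_
    rw [neg_neg]
    exact h
  tendsto_supCkENorm := D.tendsto_supCkENorm

/-- **Sources reversed, limit not ⇒ sources not, limit reversed.** [cite: ONeill1983, Ch. 5, p. 145] -/
def ofReverseSources (D : LocalSubconvergence (fun n ↦ (𝓢ₙ n).reverse) pₙ 𝓣 q k) :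
    LocalSubconvergence 𝓢ₙ pₙ 𝓣.reverse q k where
  sub := D.sub
  strictMono_sub := D.strictMono_sub
  U := D.U
  monotone_U := D.monotone_U
  mem_U := D.mem_U
  iUnion_U := D.iUnion_U
  isCompact_closure_U := D.isCompact_closure_U
  embed := D.embed
  isLocalDiffeomorphOn_embed := D.isLocalDiffeomorphOn_embed
  injOn_embed := D.injOn_embed
  embed_basepoint := D.embed_basepoint
  isFutureDirected_mfderiv_embed n x hx := by
    have h : (𝓢ₙ (D.sub n)).timeOrientation.reverse.IsFutureDirected
        (mfderiv (𝓡 4) (𝓡 4) (D.embed n) x (𝓣.timeOrientation.vectorField x)) :=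
      D.isFutureDirected_mfderiv_embed n x hx
    show (𝓢ₙ (D.sub n)).timeOrientation.IsFutureDirected
      (mfderiv (𝓡 4) (𝓡 4) (D.embed n) x (-(𝓣.timeOrientation.vectorField x)))
    have e := ContinuousLinearMap.map_neg (mfderiv (𝓡 4) (𝓡 4) (D.embed n) x)
      (𝓣.timeOrientation.vectorField x)
    refine (Iff.of_eq (congrArg ((𝓢ₙ (D.sub n)).timeOrientation.IsFutureDirected) e)).2 ?_
    exact (TimeOrientation.isFutureDirected_neg_iff _ _).2
      ((TimeOrientation.isFutureDirected_reverse_iff _ _).1 h)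
  tendsto_supCkENorm := D.tendsto_supCkENorm

/-- **Limit reversed, sources not ⇒ sources reversed, limit not.** [cite: ONeill1983, Ch. 5, p. 145] -/
def toReverseSources (D : LocalSubconvergence 𝓢ₙ pₙ 𝓣.reverse q k) :
    LocalSubconvergence (fun n ↦ (𝓢ₙ n).reverse) pₙ 𝓣 q k where
  sub := D.sub
  strictMono_sub := D.strictMono_sub
  U := D.U
  monotone_U := D.monotone_U
  mem_U := D.mem_U
  iUnion_U := D.iUnion_U
  isCompact_closure_U := D.isCompact_closure_U
  embed := D.embed
  isLocalDiffeomorphOn_embed := D.isLocalDiffeomorphOn_embed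
  injOn_embed := D.injOn_embed
  embed_basepoint := D.embed_basepoint
  isFutureDirected_mfderiv_embed n x hx := by
    have h : (𝓢ₙ (D.sub n)).timeOrientation.IsFutureDirected
        (mfderiv (𝓡 4) (𝓡 4) (D.embed n) x (-(𝓣.timeOrientation.vectorField x))) :=
      D.isFutureDirected_mfderiv_embed n x hx
    show (𝓢ₙ (D.sub n)).timeOrientation.reverse.IsFutureDirected
      (mfderiv (𝓡 4) (𝓡 4) (D.embed n) x (𝓣.timeOrientation.vectorField x))
    have e := ContinuousLinearMap.map_neg (mfderiv (𝓡 4) (𝓡 4) (D.embed n) x)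
      (𝓣.timeOrientation.vectorField x)
    have h' := (Iff.of_eq (congrArg ((𝓢ₙ (D.sub n)).timeOrientation.IsFutureDirected) e)).1 h
    exact (TimeOrientation.isFutureDirected_reverse_iff _ _).2
      ((TimeOrientation.isFutureDirected_neg_iff _ _).1 h')
  tendsto_supCkENorm := D.tendsto_supCkENorm

end LocalSubconvergence

variable {𝓢ₙ : ℕ → Spacetime.{u} 4} {pₙ : ∀ n, (𝓢ₙ n).carrier} {𝓣 : Spacetime.{v} 4}
  {q : 𝓣.carrier} {k : ℕ}

/-- **Reversing sources and limit together preserves pointed `Cᵏ_loc` subconvergence.**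
[cite: Petersen2006, Ch. 10 §3.2] -/
theorem SubconvergesLocallyTo.reverse (h : SubconvergesLocallyTo 𝓢ₙ pₙ 𝓣 q k) :
    SubconvergesLocallyTo (fun n ↦ (𝓢ₙ n).reverse) pₙ 𝓣.reverse q k :=
  h.elim fun D ↦ ⟨D.reverse⟩

/-- **Reversed sources converge to `𝓣` iff the sources converge to `𝓣.reverse`.**
[cite: Petersen2006, Ch. 10 §3.2] -/
theorem subconvergesLocallyTo_reverse_sources_iff :
    SubconvergesLocallyTo (fun n ↦ (𝓢ₙ n).reverse) pₙ 𝓣 q k ↔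
      SubconvergesLocallyTo 𝓢ₙ pₙ 𝓣.reverse q k :=
  ⟨fun h ↦ h.elim fun D ↦ ⟨D.ofReverseSources⟩, fun h ↦ h.elim fun D ↦ ⟨D.toReverseSources⟩⟩

end Spacetime

end Literature.Geometry.Lorentzian

end
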